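/-
Copyright (c) 2026 the pub-hodgecm-mathlib formalisation cell (harness21).  Prover seat hodgecm-mathlib-LH4-p04 (g2), req620 Track A «(D-RAM) FOUR-FRAME» squad
(unit U3_Laws, (KSS) road, brick «κS-DICT» FILE 2: THE Ω-RECUT of the three sign identities — (R-22), heir LEAD T18-50, REF5 (g22) R5-109, LH4-p05 (g3) 2026-09-04T02:37Z,
LH4-r01 (g4) GD∕GD2; dealer LH4-plan (g11) WORD #49 (2)).  2026-09-04.
-/
import Summits.HodgeConjecture.HodgeConjecture.Theorems.F0P3cDyRamDiagonalKappaSignDictionary   -- ★ p856809 (this seat): the engine `normSign_eq_of_germ`, (D0)∕(D1)∕(D2), the `fPart` algebra at the square datum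
import HarnessLib

/-!
# Crux `H413`, line LH4 «(D-RAM) FOUR-FRAME» road — unit U3_Laws (iii), (KSS) road, brick «κS-DICT» FILE 2: THE Ω-RECUT OF THE THREE SIGN IDENTITIES —
# `ω(f₀) = ω(u₂)·ω(−1)ω(fPP₂)`, `ω(1+f₀) = ω(u₀)·ω(fPP₀)`, `ω(f₀(1+f₀)) = ω(u₂)ω(u₀)·ω(fPP₁)` for fixed representatives `u₂ ~ b∕a`, `u₀ ~ b` modulo `U_E^{(2d−1)}`

Cell `hodgecm-mathlib` (D-0151), FLOOR 0, crux item H413 = `stmt-HodgeConjecture-24833`, route of record `HCCMUnconditional`; squad F0∕P3c∕LH4 (req618∕req620); registered stubs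
concerned: `F0P3cDyRamFourFrameU3.stub_U3_kappaSignCount_typeZero ∕ _typeTwo_mult` (κS-B₀∕κS-B₂, U3 ED. 10 :509∕:524) — UNDER (R-22) PAPER REFUTATION AS ∀-K STATEMENTS at data with
`d` even, `t∕2 + 2 ≤ d ≤ t − 2` (REF5 (g22) R5-109 (3), LH4-r01 (g4) GD, LHref-N #343, LH4-p05 (g3) «=»); this file is the POSITIVE ALGEBRA any re-lettered κS-leaf cites.
THEOREMS ONLY (no `def`, no instance, no notation, no `sorry`, default heartbeats); lane `--supports stmt-HodgeConjecture-24833 --as helper` (count-neutral).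

THE MATHEMATICS.  ★ FILE 1 (`…KappaSignDictionary`) proves the dictionary `glue token = law token` under the unit-depth hypotheses `|a − b| ≤ |ϖ|^{2d−1}`, `|b − 1| ≤ |ϖ|^{2d−1}`
(true at every place of record; REF5: dischargeable iff `d` odd ∨ `d = t` ∨ `2d ≤ t + 2`).  WITHOUT them (first at `(d,t) = (6,8)`, `e_F = 4`) the honest tokens carry an extra
factor: for a norm-one unit `c` deep enough that `c·U_E^{(2d−1)}` meets `F`, `Ω(c) := ω(u)` for any fixed `u ∈ c·U_E^{(2d−1)}` is well defined (`F ∩ U_E^{(2d−1)} = U_F^{(d)} ⊆ N`,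
★ deep norms), and the glue tokens are `Ω(c_i)·ω(−1)·ω(fPartProd_i)` with `(c₀, c₁, c₂) = (b, b²∕a, b∕a)` (LH4-p05 (g3)).  Here, with NO new definition: the engine
`normSign_eq_mul_of_germ` (`c` close to a fixed unit `u₀` instead of to `1` ⇒ `ω(f) = ω(u₀)·ω(xy)`, by ★ FILE 1's engine applied to `f∕u₀` and ★ multiplicativity of `ω` on fixed
elements), and the three recut heads with the representatives `u₂` (of `b∕a`) and `u₀` (of `b`) as binders: (R2) `normSign_glueWitness_eq_mul`, (R0)
`normSign_one_add_glueWitness_eq_mul`, (R1) `normSign_glueWitness_mul_one_add_eq_mul` (`Ω(b²∕a) = Ω(b∕a)Ω(b)`).  ★ FILE 1's (D2)∕(D0)∕(D1) are the cases `u = 1`.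
HONEST LABEL.  Count-neutral (`--supports`); nothing printed is asserted; (KSS) stays a PROVER TARGET whose ∀-K typing is under (R-22) review; `HC_CM` is proved only modulo the 7
printed citations (2 remaining named inputs: hLiu418 = `stmt-HodgeConjecture-24832`, h413 = `stmt-HodgeConjecture-24833`) until rung 0 closes.

## References
* [Rogawski1990] J. D. Rogawski, *Automorphic Representations of Unitary Groups in Three Variables*, Ann. of Math. Stud. 123 (1990), §4.9 p. 55, §4.10 p. 58.
* [Serre1979] J.-P. Serre, *Local Fields*, GTM 67 (1979), Ch. V §3 Prop. 5, Cor. 3 (the conductor of a ramified quadratic extension; deep one-units are norms), Ch. XV §2.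
-/

set_option autoImplicit false

noncomputable section

namespace Summit.HodgeConjecture.HodgeConjecture.Cruxes.H413.F0P3cDyRamDiagonalKappaSignDictionaryRecut

open Matrix
open Literature.NumberTheory.Automorphic Literature.NumberTheory.Automorphic.UnitaryThreeFourFrame
open Literature.NumberTheory.LocalFields Literature.NumberTheory.LocalFields.WildQuadraticDatum
open Summit.HodgeConjecture.HodgeConjecture.Cruxes.H413.F0P3cDyRamFixedCountDiagonalModel (normSign_mul_norm)
open Summit.HodgeConjecture.HodgeConjecture.Cruxes.H413.F0P3cDyRamDiagonalKappaSplitCountEval (normSign_mul_self)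
open Summit.HodgeConjecture.HodgeConjecture.Cruxes.H413.F0P3cDyRamCayleySignFPartProd (fPartProd_two)
open Summit.HodgeConjecture.HodgeConjecture.Cruxes.H413.F0P3cDyRamDiagonalKappaSignDictionary
open scoped Valued WithZero Matrix MatrixGroups

variable {K : Type} [Field K] [Valued K ℤᵐ⁰]

/-! ## §1 THE Ω-RECUT — the same identities WITHOUT the unit-depth hypotheses `hab`∕`hb1`, with an explicit σ-fixed representative `u` of the
class of the norm-one unit (`b∕a` resp. `b`) modulo `U_E^{(2d−1)}`: the glue tokens are `ω(u)·(law token)` ((R-22): REF5 (g22) R5-109, LH4-p05 (g3) 02:37Z «Ω(c_i)·ω(−1)ω(fPP_i),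
(c₀,c₁,c₂) = (b, b²∕a, b∕a)», LH4-r01 (g4) GD∕GD2 numeric witness at (d,t) = (6,8)).  ★ `KappaSignDictionary`'s heads are the case `u = 1`. -/

/-- **Ω-RECUT ENGINE.**  As `normSign_eq_of_germ`, but the unit `c` is only assumed close to a σ-FIXED unit `u₀` (`|c − u₀| ≤ |ϖ|^n`, `|u₀| = 1`) instead of to `1`; then
`ω(f) = ω(u₀)·ω(x·y)` (apply the engine to `f∕u₀ ≈ (c∕u₀)·(x∕y)`; ω is multiplicative on fixed non-zero elements). [cite: Serre1979, Ch. V §3 Prop. 5, Cor. 3] [cite: Rogawski1990, §4.9 p. 55] -/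
theorem normSign_eq_mul_of_germ [CompleteSpace K] [Fintype 𝓀[K]] {σ : K →+* K} {ϖ : K} {d t : ℕ} (hD : IsRamifiedQuadraticDatum σ ϖ d t)
    {x y f c u₀ : K} (hσx : σ x = x) (hσy : σ y = y) (hx0 : x ≠ 0) (hy0 : y ≠ 0) (hσf : σ f = f) (hf0 : f ≠ 0) (hσu₀ : σ u₀ = u₀) (hu₀ : Valued.v u₀ = 1)
    {n : ℕ} (hn : 2 * d - 1 ≤ n) (hc : Valued.v (c - u₀) ≤ Valued.v ϖ ^ n) (hf : Valued.v (f - c * (x / y)) ≤ Valued.v ϖ ^ n * Valued.v (x / y)) :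
    normSign σ f = normSign σ u₀ * normSign σ (x * y) := by
  have hu₀0 : u₀ ≠ 0 := fun h => by rw [h, map_zero] at hu₀; exact zero_ne_one hu₀
  have hσf' : σ (f * u₀⁻¹) = f * u₀⁻¹ := by rw [map_mul, map_inv₀, hσf, hσu₀]
  have hf'0 : f * u₀⁻¹ ≠ 0 := mul_ne_zero hf0 (inv_ne_zero hu₀0)
  have hc' : Valued.v (c * u₀⁻¹ - 1) ≤ Valued.v ϖ ^ n := by
    have e : c * u₀⁻¹ - 1 = (c - u₀) * u₀⁻¹ := by field_simp
    rw [e, map_mul, map_inv₀, hu₀, inv_one, mul_one]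
    exact hc
  have hf' : Valued.v (f * u₀⁻¹ - c * u₀⁻¹ * (x / y)) ≤ Valued.v ϖ ^ n * Valued.v (x / y) := by
    have e : f * u₀⁻¹ - c * u₀⁻¹ * (x / y) = (f - c * (x / y)) * u₀⁻¹ := by ring
    rw [e, map_mul, map_inv₀, hu₀, inv_one, mul_one]
    exact hf
  rw [show f = u₀ * (f * u₀⁻¹) from by field_simp, normSign_mul_of_fixed hD hσu₀ hσf' hu₀0 hf'0,
    normSign_eq_of_germ hD hσx hσy hx0 hy0 hσf' hn hc' hf']

/-- **(R2) THE GLUE WITNESS, RECUT: `ω(f₀) = ω(u)·ω(−1)·ω(fPartProd δ (a,b,1) 2)`** for any σ-fixed unit `u` with `|b∕a − u| ≤ |ϖ|^n` (a representative of `Ω(b∕a)`), the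
relative glue depth `|f₀ + g| ≤ |ϖ|^n·|g|` and `2d − 1 ≤ n` — NO hypothesis on `|a − b|`.  (★ (D2) `normSign_glueWitness_eq` = the case `u = 1`.)
[cite: Rogawski1990, §4.9 p. 55, §4.10 p. 58] [cite: Serre1979, Ch. V §3 Prop. 5, Cor. 3] -/
theorem normSign_glueWitness_eq_mul [CompleteSpace K] [Fintype 𝓀[K]] {σ : K →+* K} {ϖ : K} {d t : ℕ} (hD : IsRamifiedQuadraticDatum σ ϖ d t)
    {δ a b : K} (hδ : σ δ = -δ) (hδ0 : δ ≠ 0) (ha : a * σ a = 1) (hb : b * σ b = 1) (hα1 : a * a ≠ 1) (hβ1 : b * b ≠ 1)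
    {f₀ : K} (hσf₀ : σ f₀ = f₀) (hf00 : f₀ ≠ 0) {n : ℕ} (hn : 2 * d - 1 ≤ n)
    {u : K} (hσu : σ u = u) (hu : Valued.v u = 1) (hbu : Valued.v (b / a - u) ≤ Valued.v ϖ ^ n)
    (hf₀ : Valued.v (f₀ + (b * b - 1) / (a * a - 1)) ≤ Valued.v ϖ ^ n * Valued.v ((b * b - 1) / (a * a - 1))) :
    normSign σ f₀ = normSign σ u * (normSign σ (-1) * normSign σ (fPartProd δ ![a, b, 1] 2)) := by
  have hvσ := hD.2.1
  have ha0 := ne_zero_of_mul_map_eq_one ha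
  have hb0 := ne_zero_of_mul_map_eq_one hb
  have hva : Valued.v a = 1 := v_eq_one_of_mul_map_eq_one hvσ ha
  have hvb : Valued.v b = 1 := v_eq_one_of_mul_map_eq_one hvσ hb
  have h1ne : (1 : K) * 1 ≠ b * b := fun h => hβ1 (by rw [← h, mul_one])
  have hx : σ (fPart δ ![a, b, 1] 2 1) = fPart δ ![a, b, 1] 2 1 := map_fPart_eq hδ ha hb 2 1
  have hy : σ (fPart δ ![a, b, 1] 0 2) = fPart δ ![a, b, 1] 0 2 := map_fPart_eq hδ ha hb 0 2
  have hx0 : fPart δ ![a, b, 1] 2 1 ≠ 0 := fPart_ne_zero (l := ![a, b, 1]) hδ0 (by simp) (by simp [hb0]) (by simpa using h1ne)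
  have hy0 : fPart δ ![a, b, 1] 0 2 ≠ 0 := fPart_ne_zero (l := ![a, b, 1]) hδ0 (by simp [ha0]) (by simp) (by simpa using hα1)
  have hgerm : (b / a) * (fPart δ ![a, b, 1] 2 1 / fPart δ ![a, b, 1] 0 2) = -((b * b - 1) / (a * a - 1)) :=
    (neg_glueUnit_eq hδ0 ha0 hb0 hα1).symm
  have hvq : Valued.v (fPart δ ![a, b, 1] 2 1 / fPart δ ![a, b, 1] 0 2) = Valued.v ((b * b - 1) / (a * a - 1)) := by
    have e : fPart δ ![a, b, 1] 2 1 / fPart δ ![a, b, 1] 0 2 = (a / b) * -((b * b - 1) / (a * a - 1)) := by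
      rw [← hgerm]; field_simp
    rw [e, map_mul, Valuation.map_neg, map_div₀, hva, hvb, div_one, one_mul]
  have hf : Valued.v (f₀ - b / a * (fPart δ ![a, b, 1] 2 1 / fPart δ ![a, b, 1] 0 2)) ≤
      Valued.v ϖ ^ n * Valued.v (fPart δ ![a, b, 1] 2 1 / fPart δ ![a, b, 1] 0 2) := by
    rw [hgerm, sub_neg_eq_add, hvq]
    exact hf₀
  rw [normSign_eq_mul_of_germ hD hx hy hx0 hy0 hσf₀ hf00 hσu hu hn hbu hf, fPart_two_one_mul_zero_two hδ0 ha0 hb0, neg_eq_neg_one_mul,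
    normSign_mul_of_fixed hD (by rw [map_neg, map_one]) ?_ (neg_ne_zero.2 one_ne_zero) ?_]
  · rw [fPartProd_two, map_mul, map_fPart_eq hδ ha hb, map_fPart_eq hδ ha hb]
  · rw [fPartProd_two]
    exact mul_ne_zero (fPart_ne_zero (l := ![a, b, 1]) hδ0 (by simp) (by simp [ha0]) (by simpa using fun h => hα1 h.symm)) hx0

/-- **(R0) THE APEX, RECUT: `ω(1 + f₀) = ω(u)·ω(fPartProd δ (a,b,1) 0)`** for any σ-fixed unit `u` with `|b − u| ≤ |ϖ|^n` (a representative of `Ω(b)`), the relative glue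
depth `|f₀ + g| ≤ |ϖ|^n·|1 − g|` and `2d − 1 ≤ n` — NO hypothesis on `|b − 1|`.  (★ (D0) `normSign_one_add_glueWitness_eq` = the case `u = 1`.)
[cite: Rogawski1990, §4.9 p. 55, §4.10 p. 58] [cite: Serre1979, Ch. V §3 Prop. 5, Cor. 3] -/
theorem normSign_one_add_glueWitness_eq_mul [CompleteSpace K] [Fintype 𝓀[K]] {σ : K →+* K} {ϖ : K} {d t : ℕ} (hD : IsRamifiedQuadraticDatum σ ϖ d t)
    {δ a b : K} (hδ : σ δ = -δ) (hδ0 : δ ≠ 0) (ha : a * σ a = 1) (hb : b * σ b = 1) (hα1 : a * a ≠ 1) (hαβ : a * a ≠ b * b)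
    {f₀ : K} (hσf₀ : σ f₀ = f₀) (hf1 : 1 + f₀ ≠ 0) {n : ℕ} (hn : 2 * d - 1 ≤ n)
    {u : K} (hσu : σ u = u) (hu : Valued.v u = 1) (hbu : Valued.v (b - u) ≤ Valued.v ϖ ^ n)
    (hf₀ : Valued.v (f₀ + (b * b - 1) / (a * a - 1)) ≤ Valued.v ϖ ^ n * Valued.v (1 - (b * b - 1) / (a * a - 1))) :
    normSign σ (1 + f₀) = normSign σ u * normSign σ (fPartProd δ ![a, b, 1] 0) := by
  have hvσ := hD.2.1
  have ha0 := ne_zero_of_mul_map_eq_one ha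
  have hb0 := ne_zero_of_mul_map_eq_one hb
  have hvb : Valued.v b = 1 := v_eq_one_of_mul_map_eq_one hvσ hb
  have hx : σ (fPart δ ![a, b, 1] 0 1) = fPart δ ![a, b, 1] 0 1 := map_fPart_eq hδ ha hb 0 1
  have hy : σ (fPart δ ![a, b, 1] 0 2) = fPart δ ![a, b, 1] 0 2 := map_fPart_eq hδ ha hb 0 2
  have hx0 : fPart δ ![a, b, 1] 0 1 ≠ 0 := fPart_ne_zero (l := ![a, b, 1]) hδ0 (by simp [ha0]) (by simp [hb0]) (by simpa using hαβ)
  have hy0 : fPart δ ![a, b, 1] 0 2 ≠ 0 := fPart_ne_zero (l := ![a, b, 1]) hδ0 (by simp [ha0]) (by simp) (by simpa using hα1)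
  have hgerm : b * (fPart δ ![a, b, 1] 0 1 / fPart δ ![a, b, 1] 0 2) = 1 - (b * b - 1) / (a * a - 1) :=
    (one_sub_glueUnit_eq hδ0 ha0 hb0 hα1).symm
  have hvq : Valued.v (fPart δ ![a, b, 1] 0 1 / fPart δ ![a, b, 1] 0 2) = Valued.v (1 - (b * b - 1) / (a * a - 1)) := by
    have e : fPart δ ![a, b, 1] 0 1 / fPart δ ![a, b, 1] 0 2 = b⁻¹ * (1 - (b * b - 1) / (a * a - 1)) := by
      rw [← hgerm]; field_simp
    rw [e, map_mul, map_inv₀, hvb, inv_one, one_mul]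
  have hf : Valued.v (1 + f₀ - b * (fPart δ ![a, b, 1] 0 1 / fPart δ ![a, b, 1] 0 2)) ≤
      Valued.v ϖ ^ n * Valued.v (fPart δ ![a, b, 1] 0 1 / fPart δ ![a, b, 1] 0 2) := by
    rw [hgerm, hvq, show 1 + f₀ - (1 - (b * b - 1) / (a * a - 1)) = f₀ + (b * b - 1) / (a * a - 1) from by ring]
    exact hf₀
  have hσf : σ (1 + f₀) = 1 + f₀ := by rw [map_add, map_one, hσf₀]
  rw [normSign_eq_mul_of_germ hD hx hy hx0 hy0 hσf hf1 hσu hu hn hbu hf, fPartProd_zero]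

/-- **(R1) THE CROSS SLOT, RECUT: `ω(f₀·(1 + f₀)) = ω(u₂)·ω(u₀)·ω(fPartProd δ (a,b,1) 1)`** with `u₂` a fixed representative of `Ω(b∕a)` and `u₀` of `Ω(b)` (so `u₂u₀`
represents `Ω(b²∕a)`), under the hypotheses of (R2) and (R0).  (★ (D1) = the case `u₂ = u₀ = 1`.) [cite: Rogawski1990, §4.9 p. 55, §4.10 p. 58] [cite: Serre1979, Ch. V §3 Prop. 5, Cor. 3] -/
theorem normSign_glueWitness_mul_one_add_eq_mul [CompleteSpace K] [Fintype 𝓀[K]] {σ : K →+* K} {ϖ : K} {d t : ℕ} (hD : IsRamifiedQuadraticDatum σ ϖ d t)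
    {δ a b : K} (hδ : σ δ = -δ) (hδ0 : δ ≠ 0) (ha : a * σ a = 1) (hb : b * σ b = 1) (hα1 : a * a ≠ 1) (hβ1 : b * b ≠ 1) (hαβ : a * a ≠ b * b)
    {f₀ : K} (hσf₀ : σ f₀ = f₀) (hf0 : f₀ ≠ 0) (hf1 : 1 + f₀ ≠ 0) {n : ℕ} (hn : 2 * d - 1 ≤ n)
    {u₂ u₀ : K} (hσu₂ : σ u₂ = u₂) (hu₂ : Valued.v u₂ = 1) (hbu₂ : Valued.v (b / a - u₂) ≤ Valued.v ϖ ^ n)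
    (hσu₀ : σ u₀ = u₀) (hu₀ : Valued.v u₀ = 1) (hbu₀ : Valued.v (b - u₀) ≤ Valued.v ϖ ^ n)
    (hf₀ : Valued.v (f₀ + (b * b - 1) / (a * a - 1)) ≤ Valued.v ϖ ^ n * Valued.v ((b * b - 1) / (a * a - 1)))
    (hf₀' : Valued.v (f₀ + (b * b - 1) / (a * a - 1)) ≤ Valued.v ϖ ^ n * Valued.v (1 - (b * b - 1) / (a * a - 1))) :
    normSign σ (f₀ * (1 + f₀)) = normSign σ u₂ * normSign σ u₀ * normSign σ (fPartProd δ ![a, b, 1] 1) := by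
  have hσf1 : σ (1 + f₀) = 1 + f₀ := by rw [map_add, map_one, hσf₀]
  have hprod := normSign_fPartProd_two_mul_zero hD hδ hδ0 ha hb hα1 hβ1 hαβ
  rw [normSign_mul_of_fixed hD hσf₀ hσf1 hf0 hf1, normSign_glueWitness_eq_mul hD hδ hδ0 ha hb hα1 hβ1 hσf₀ hf0 hn hσu₂ hu₂ hbu₂ hf₀,
    normSign_one_add_glueWitness_eq_mul hD hδ hδ0 ha hb hα1 hαβ hσf₀ hf1 hn hσu₀ hu₀ hbu₀ hf₀']
  linear_combination (normSign σ u₂ * normSign σ u₀ * normSign σ (-1)) * hprod +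
    (normSign σ u₂ * normSign σ u₀ * normSign σ (fPartProd δ ![a, b, 1] 1)) * normSign_mul_self σ (-1 : K)

end Summit.HodgeConjecture.HodgeConjecture.Cruxes.H413.F0P3cDyRamDiagonalKappaSignDictionaryRecut

end
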